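import Mathlib
import Literature.AlgebraicGeometry.HodgeTheory.FermatShiodaCondition

/-!
# THEOREM B2 — Aoki–Shioda's `(𝔅²_N)(i)` at the squarefree levels `N` prime to `6` — the STATEMENT (count-neutral)

Cell `pub-hfermat` (tree path `Summits/HodgeConjecture/FermatCycles/`), seat prover-1 gen-5, acting on the COORDINATOR KEEPER
RULING of 2026-08-25 (gem sweep H1: take the sibling package's off-gate kernel theorems through the normal gate, statement
first).  THEOREM B2 of the sibling cell's standalone package `run/shared/lean/pub/pub-hodgefermat/lean/HodgeFermat/`
(pub-hodgefermat `CERT.md` l.930, GATE HF-G28b; modules `HodgeFermat/TheoremB2.lean`, 204 lines, sha256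
`9b7a84ad3bbd49d6…`, and `HodgeFermat/TheoremB2Final.lean`, 46 lines, sha256 `6109533091f23973…`; cell
records `check/B2_standalone.lean` + the link check `check/B2Link_standalone.lean`, hub `lean check` rc 0, GATE.md § HF-G28b)
was never put through the gate.  This file files its STATEMENT first — the two `Prop`-valued definitions `TwoPairs` and
`B2` of `TheoremB2.lean` (source lines 56–64), byte-identical, and nothing else; the proof follows in `HodgeFermatTheoremB2.lean`
(the rest of both modules verbatim, on top of the landed THEOREM KR6 in multiset form `HodgeFermat.KRFree.TheoremKR.kr6Multiset`,
file `HodgeFermatPropDPrimeNFinal.lean`), ending in the sibling's own closing theorem `HodgeFermat.KRFree.TheoremB2.b2 : B2`.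

THE STATEMENT (Aoki–Shioda [AokiShioda1983, Theorem (𝔅²_m)(i)]: if `(m, 6) = 1`, every Hodge quadruple
`(a₀, a₁, a₂, a₃) ∈ 𝔅²_m` is decomposable — `aᵢ + aⱼ ≡ 0 (mod m)` for some `i ≠ j` —, i.e. it is a sum of two pairs
`{a, −a} + {b, −b}`; here AT THE SQUAREFREE LEVELS `N` PRIME TO `6`, exactly the levels of THEOREM KR6).  For every squarefree
`N` with `2 ∤ N`, `3 ∤ N` and every multiset `s` of four elements of `ℤ/N` which is a HODGE MULTISET in the sense of the tree's
`Literature.AlgebraicGeometry.HodgeTheory.FermatCharacter.IsHodgeMultiset` (`Literature/AlgebraicGeometry/HodgeTheory/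
FermatShiodaCondition.lean`, imported — the very file the sibling vendored, sha256 `8f58f8d64694…`: all elements non-zero, sum `0`,
Shioda's length condition `2 · Σ⟨t a⟩ = N · #s` at every unit `t`), there are `a b : ℤ/N` with `s = {a, −a, b, −b}` (`TwoPairs s`).
Context: `IsHodgeMultiset` is the multiset form of the Hodge characters `𝔅ⁿ_m` indexing the Hodge classes of the Fermat variety
`Xⁿ_m` (Shioda 1979; `isHodge_iff_isHodgeMultiset` there); `(𝔅²_m)(i)` is the input of Aoki–Shioda's theorem on the Hodge
classes of Fermat fourfolds and of every «imports Aoki–Shioda» line of the sibling's `tables/KR-FREE.md` — which THEOREM B2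
makes import-free at these levels (no claim on general Hodge is made or implied here).  The hypothesis `3 ∤ N` cannot be dropped
(Shioda's `σ₃`-type quadruple `{1, 6, 11, 12}` of level `15`, an `example` in the proof file); non-squarefree levels prime to `6`
are Aoki–Shioda's theorem but not this statement's.

Deviations from the source lines: the `import` lines (`Mathlib`, and the tree's `Literature.AlgebraicGeometry.HodgeTheory.FermatShiodaCondition`
for the sibling's vendored copy `HodgeFermat.Vendored.FermatShiodaCondition`); this docstring; of the module's two `open` lines only
the second is kept, restricted to `(IsHodgeMultiset)` exactly as in `TheoremB2Final.lean` l.27 (the first opens `LemmaN`, not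
needed by the two definitions).  The two definitions and their docstrings are byte-identical to `TheoremB2.lean` l.56–64.

HONEST FRAMING: explicit algebraic cycles for specific Hodge classes on Fermat/Delsarte varieties; residual open instances
listed; no claim on general Hodge.  No `sorry`; two `Prop`-valued definitions (count-neutral).

The docstring of `HodgeFermat/TheoremB2.lean` (l.7–37), verbatim:

## THEOREM B2 — Aoki–Shioda's `(𝔅²_m)(i)` at the squarefree levels prime to `6`, from THEOREM KR6 (HF-G28b)

Aoki–Shioda [AokiShioda1983, Theorem (𝔅²_m)(i); `tables/LAMBDA-THEOREM.md` §4.2]: *if `(m, 6) = 1`, every Hodge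
quadruple `(a₀, a₁, a₂, a₃) ∈ 𝔅²_m` is decomposable — `aᵢ + aⱼ ≡ 0 (mod m)` for some `i ≠ j`*, i.e. (the sum being
`0`) it is a sum of two pairs `{a, −a} + {b, −b}`.  This is the input of THEOREM H4 and, through it, of every
"imports Aoki–Shioda" line of `tables/KR-FREE.md`.  This module proves it **in the kernel at every SQUAREFREE level
`N` prime to `6`**, for Hodge multisets in the sense of the vendored `Literature` predicate `IsHodgeMultiset`
(all elements non-zero, sum `0`, Shioda length `2 · Σ⟨t a⟩ = N · #s` at every unit `t`), with NO unit hypothesis on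
the entries (generation 27's `CorollaryUPrimeFinal.quadruple_odd` needed all four entries to be units; here entries
divisible by primes of `N` are allowed) — from THEOREM KR6 in multiset form (`TheoremKRFinal.kr6Multiset`,
generation 28), which this LIGHT module takes as the hypothesis `KR6Multiset'` (a verbatim copy of
`TheoremKR.KR6Multiset`, so that the record of this module does not re-elaborate the THEOREM U chain; the final
module `TheoremB2Final.lean` discharges it definitionally, `kr6Multiset' := TheoremKR.kr6Multiset`).

THE BRIDGE (`sameType_of_hodge4`).  Let `s = {x, y, z, w}` be a Hodge multiset of level `N`.  If `x + y = 0` then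
`z + w = 0` and `s = {x, −x} + {z, −z}`.  Otherwise the two triples `T = (x, y, −(x+y))` and `T' = (−z, −w, −(x+y))`
(representatives `ZMod.val`) have zero sum and no entry `≡ 0`, and THE SAME CM TYPE: at a unit `t`, Shioda's length
condition reads `⟨tx⟩ + ⟨ty⟩ + ⟨tz⟩ + ⟨tw⟩ = 2N`, so `t ∈ H_T ⟺ ⟨tx⟩ + ⟨ty⟩ < N ⟺ ⟨tz⟩ + ⟨tw⟩ > N ⟺
(N − ⟨tz⟩) + (N − ⟨tw⟩) < N ⟺ t ∈ H_{T'}` (`⟨−v⟩ = N − ⟨v⟩` for `v ≢ 0`).  THEOREM KR6 (multiset form) gives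
`{x, y, −(x+y)} = {−z, −w, −(x+y)}` in `ℤ/N`, hence `{x, y} = {−z, −w}`, i.e. `s = {x, −x} + {y, −y}`.

SCOPE.  Squarefree `N` with `(N, 6) = 1` only — exactly the levels of THEOREM KR6.  The hypothesis `3 ∤ N` cannot be
dropped (`example` below: Shioda's `σ₃`-type quadruple `{1, 6, 11, 12}` of level `15` is a Hodge multiset and is not
two pairs); non-squarefree levels prime to `6` (`25, 35², …`) are Aoki–Shioda's theorem but not this module's.

Main declarations
* `KR6Multiset'` : verbatim copy of `TheoremKR.KR6Multiset` (the hypothesis of this light module);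
* `TwoPairs s` : `∃ a b, s = {a, −a, b, −b}`;  `B2` : the statement;  `b2_of_kr6 : KR6Multiset' → B2`;
* `sameType_of_hodge4` : the bridge;  `decomposable_of_twoPairs` : the Aoki–Shioda wording (`∃` two entries summing to `0`).
-/

set_option autoImplicit false

namespace HodgeFermat.KRFree.TheoremB2

open Literature.AlgebraicGeometry.HodgeTheory.FermatCharacter (IsHodgeMultiset)

/-- `s` is a sum of two pairs `{a, −a} + {b, −b}`. -/
def TwoPairs {N : ℕ} (s : Multiset (ZMod N)) : Prop :=
  ∃ a b : ZMod N, s = {a, -a, b, -b}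

/-- **THEOREM B2** (statement): at a squarefree level `N` prime to `6`, every Hodge multiset with four elements is a
sum of two pairs — Aoki–Shioda's `(𝔅²_N)(i)` at these levels. -/
def B2 : Prop :=
  ∀ N : ℕ, Squarefree N → ¬ 2 ∣ N → ¬ 3 ∣ N →
    ∀ s : Multiset (ZMod N), IsHodgeMultiset s → Multiset.card s = 4 → TwoPairs s

end HodgeFermat.KRFree.TheoremB2
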